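import Mathlib
import Summits.RiemannHypothesis.RiemannHypothesis.Theorems.JensenPolynomialsCumulantDefs

/-!
# Route `JensenPolynomials` — crux child `XiCumulantMajorantCap` (stmt-RiemannHypothesis-19217), part 1:
the ℕ fixed-point CHECKER (computation only; soundness is part 2).

RH-FREE, γ-FREE proof-of-data (rung J-P(P1′), cell rh-jensen, engine target ET1 «C2GEN-CERT»).  The numeric child
`XiCumulantMajorantCap` of crux 19709 says: for every `d ≥ 3` the two all-plus majorant sums
`S₁(d) = Σ_{j=1}^{d} (d)_j·e_j·ρ_winMin(d,j)` and `S₂(d) = Σ_{j=1}^{d} (d)_j·e_j·(2/B_d)^j` are `< 1`, where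
`e = cumulantCoeff c`, `c_k = a(k)(k−1)!2^{k/2}M^{−(k−2)/2}`, `a(k) = 9/8 (k ≤ 3), k4^{k−3}/3 (k ≥ 4)`,
`M = max(10⁴, 2d³) + d`, `B_d = 2√(2d+1) + 2` (Theses/JensenPolynomials.lean, item 19217).  This file defines the real objects in the scaled frame and a
COMPUTABLE test `capCheck d : Bool` on natural numbers only (fixed point `2^-prec`, every operation rounded UPWARD,
square roots through run-time-checked integer witnesses), in the SCALED frame `ẽ_j = e_j·(d/2)^{j/2}`,
`b̃_k = c_k (d/2)^{k/2}/(k−1)! = a(k)·M·(d/M)^{k/2}`, with k-truncation at `KK` (remainder `TU`) and j-truncation at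
`JJ` (uniform tail bound `etaU`).  Part 2 proves `capCheck d = true → S₁(d) < 1 ∧ S₂(d) < 1`; part 3 runs the check
for `3 ≤ d ≤ D₀`.  Nothing here bears on the truth of RH.
-/

-- D-0017: `Summit.RiemannHypothesis.RiemannHypothesis.…` duplicates the namespace BY DESIGN (single-problem summit).
set_option linter.dupNamespace false

open Finset

namespace Summit.RiemannHypothesis.RiemannHypothesis.Theorems.JensenPolynomials.CapCert

/-! ## Fixed-point naturals: a natural `n` stands for the real `n / ONE`. -/

/-- Precision in bits. -/
def prec : ℕ := 96
/-- The fixed-point unit `2^prec`. -/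
def ONE : ℕ := 2 ^ prec
/-- k-truncation order of the cumulant recursion. -/
def KK : ℕ := 30
/-- j-truncation of the two sums. -/
def JJ : ℕ := 150

/-- Ceiling division (for `b > 0`). -/
def cdiv (a b : ℕ) : ℕ := (a + b - 1) / b
/-- Upward product of two fixed-point numbers. -/
def mulU (a b : ℕ) : ℕ := cdiv (a * b) ONE
/-- Upward fixed-point image of the rational `p/q` (`q > 0`). -/
def ofRatU (p q : ℕ) : ℕ := cdiv (p * ONE) q
/-- Upward fixed-point power. -/
def powU (u : ℕ) : ℕ → ℕ
  | 0 => ONE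
  | n + 1 => mulU (powU u n) u

/-- Integer square-root CANDIDATE by bisection with fuel (its value is only used through run-time checks). -/
def isqrtGo (n : ℕ) : ℕ → ℕ → ℕ → ℕ
  | 0, low, _ => low
  | f + 1, low, high => if high ≤ low + 1 then low else
      if ((low + high) / 2) * ((low + high) / 2) ≤ n then isqrtGo n f ((low + high) / 2) high
      else isqrtGo n f low ((low + high) / 2)
/-- Integer square-root candidate of `n` (intended `⌊√n⌋`; unproved, checked where used). -/
def isqrtC (n : ℕ) : ℕ := isqrtGo n 400 0 (n + 1)
/-- Upward square root: a fixed-point `r` with `√(a/ONE) ≤ r/ONE` (checked witness, trivial fallback). -/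
def sqrtU (a : ℕ) : ℕ :=
  if a * ONE < (isqrtC (a * ONE) + 1) * (isqrtC (a * ONE) + 1) then isqrtC (a * ONE) + 1 else a * ONE + 1
/-- Downward square root: a fixed-point `r` with `r/ONE ≤ √(a/ONE)` (checked witness, fallback `0`). -/
def sqrtD (a : ℕ) : ℕ :=
  if isqrtC (a * ONE) * isqrtC (a * ONE) ≤ a * ONE then isqrtC (a * ONE) else 0
/-- Tangent bounds `√P ≤ (P + t²)/(2t)`, `t = i/8`, `i = 1…8`: an upper fixed point of `√(P/ONE)`. -/
def sqrtTangU (P : ℕ) : ℕ :=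
  ((List.range 8).map (fun i => cdiv (4 * (64 * P + (i + 1) ^ 2 * ONE)) (64 * (i + 1)))).foldr min (P + ONE)
/-- Maximum of a list of naturals (`0` for the empty list). -/
def lmax (l : List ℕ) : ℕ := l.foldr max 0

/-! ## The per-degree quantities (spec functions; `capCheck` shares their values through `let`s) -/

/-- `M_d = max(10⁴, 2d³) + d`. -/
def Mof (d : ℕ) : ℕ := max 10000 (2 * d ^ 3) + d
/-- Upper fixed point of `x = √(d/M)`. -/
def xU (d : ℕ) : ℕ := sqrtU (ofRatU d (Mof d))
/-- Upper fixed point of `b̃_k = a(k)·M·(d/M)^{k/2}` (`k ≥ 3`) from an upper fixed point `x` of `√(d/M)`. -/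
def btUx (d x k : ℕ) : ℕ :=
  if k = 3 then cdiv (9 * d * x) 8
  else if k % 2 = 0 then ofRatU (k * Mof d * (16 * d) ^ (k / 2)) (192 * Mof d ^ (k / 2))
  else mulU (ofRatU (k * Mof d * (16 * d) ^ (k / 2)) (192 * Mof d ^ (k / 2))) (4 * x)
/-- The memo list `[b̃⁺_3, …, b̃⁺_KK]`. -/
def btListx (d x : ℕ) : List ℕ := (List.range (KK - 2)).map (fun i => btUx d x (i + 3))
/-- Upper fixed point of `B_K = Σ_{k=3}^{KK} b̃_k`, indexed as `Σ_{i<KK, 2≤i} b̃⁺_{i+1}`. -/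
def BKof (bts : List ℕ) : ℕ := ∑ i ∈ range KK, (if 2 ≤ i then bts.getD (i - 2) 0 else 0)
/-- Upper fixed point of `y' = (KK+2)·4x/(KK+1)`. -/
def ypOf (x : ℕ) : ℕ := cdiv ((KK + 2) * (4 * x)) (KK + 1)
/-- Upper fixed point of the k-tail `T_K ≥ Σ_{k>KK} b̃_k`: `(M(KK+1)/192)·y^{KK+1}/(1 − y')`, `y = 4x` (needs `y' < 1`). -/
def Tof (d x : ℕ) : ℕ := cdiv (ofRatU (Mof d * (KK + 1)) 192 * powU (4 * x) (KK + 1)) (ONE - ypOf x)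
/-- From the table `prev = [ẽ⁺_{j-1}, …, ẽ⁺_0]` compute `ẽ⁺_j` (meant for `j ≥ 3`):
`ẽ⁺_j = ⌈(Σ_{i<j, 2≤i<KK} b̃⁺_{i+1} ẽ⁺_{j-1-i} + [KK<j]·T) / j⌉`. -/
def etStep (bts : List ℕ) (T : ℕ) (prev : List ℕ) (j : ℕ) : ℕ :=
  cdiv ((∑ i ∈ range j, (if 2 ≤ i ∧ i < KK then bts.getD (i - 2) 0 * prev.getD i 0 else 0))
    + (if KK < j then T * ONE else 0)) (j * ONE)
/-- The reversed memo table `[ẽ⁺_n, …, ẽ⁺_0]`. -/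
def etTab (bts : List ℕ) (T : ℕ) : ℕ → List ℕ
  | 0 => [ONE]
  | n + 1 =>
    let prev := etTab bts T n
    (if n + 1 < 3 then 0 else etStep bts T prev (n + 1)) :: prev
/-- `ẽ⁺_j` (head of the table of length `j + 1`). -/
def etU (bts : List ℕ) (T : ℕ) (j : ℕ) : ℕ := (etTab bts T j).headD 0
/-- `P⁺_j`, upper fixed point of `(d)_j/d^j` (`P⁺_0 = P⁺_1 = ONE`). -/
def PU (d : ℕ) : ℕ → ℕ
  | 0 => ONE
  | j + 1 => if j = 0 then ONE else cdiv (PU d j * (d - j)) d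
/-- Upper fixed point of the scaled weight `W₁(j) = (d)_j ρ_winMin(d,j) (2/d)^{j/2}` (row identities in part 2),
from upper fixed points `sqd ≥ √d`, `r3 ≥ √((4d−2)/d)`. -/
def W1U (d sqd r3 j : ℕ) : ℕ :=
  if j ≤ 1 then 0
  else if j = 2 then ONE
  else if j = 3 then r3
  else if j = 4 then 3 * ONE
  else if j = 5 ∧ 8 ≤ d then min (mulU sqd (sqrtTangU (PU d j))) (ofRatU (4 * d + 10) d)
  else if j = 6 ∧ 9 ≤ d then min (mulU sqd (sqrtTangU (PU d j))) (ofRatU (5 * d ^ 2 + 30 * d + 8) (d ^ 2))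
  else if 4 * (j - 2) ^ 3 ≤ d then cdiv (6 * (j - 1) * PU d j) 5
  else mulU sqd (sqrtTangU (PU d j))
/-- Upper fixed point of `√d`. -/
def sqdU (d : ℕ) : ℕ := sqrtU (d * ONE)
/-- Upper fixed point of `√((4d−2)/d)`. -/
def r3U (d : ℕ) : ℕ := sqrtU (ofRatU (4 * d - 2) d)
/-- Upper fixed point of `g = √(2d)/(√(2d+1)+1)`. -/
def gU (d : ℕ) : ℕ := cdiv (sqrtU (2 * d * ONE) * ONE) (sqrtD ((2 * d + 1) * ONE) + ONE)
/-- The j-cut `Jd = min d JJ`. -/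
def Jd (d : ℕ) : ℕ := min d JJ
/-- Uniform tail bound `η ≥ ẽ⁺_i` (`JJ − KK < i ≤ JJ`) with `T ≤ η·(JJ + 1 − B_K)`. -/
def etaOf (ets : List ℕ) (T BK : ℕ) : ℕ := max (lmax (ets.take KK)) (cdiv (T * ONE) ((JJ + 1) * ONE - BK))
/-- Upper fixed point of `W₁(j)` for every `j ≥ 7`: `max((6/5)(d−1), √d)`. -/
def WmaxOf (d sqd : ℕ) : ℕ := max (cdiv (6 * (d - 1) * ONE) 5) sqd
/-- Upper fixed point of `S₁(d)` from the shared data. -/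
def S1of (d sqd r3 eta : ℕ) (ets : List ℕ) : ℕ :=
  (∑ j ∈ range (Jd d), mulU (W1U d sqd r3 (j + 1)) (ets.getD (Jd d - (j + 1)) 0))
    + (if JJ < d then mulU (eta * (d - JJ)) (WmaxOf d sqd) else 0)
/-- Upper fixed point of `S₂(d)` from the shared data. -/
def S2of (d g eta : ℕ) (ets : List ℕ) : ℕ :=
  (∑ j ∈ range (Jd d), mulU (mulU (PU d (j + 1)) (powU g (j + 1))) (ets.getD (Jd d - (j + 1)) 0))
    + (if JJ < d then eta * (d - JJ) else 0)

/-- THE CHECK of degree `d` (all shared quantities computed once). -/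
def capCheck (d : ℕ) : Bool :=
  let x := xU d
  let bts := btListx d x
  let BK := BKof bts
  let T := Tof d x
  let ets := etTab bts T (Jd d)
  let sqd := sqdU d
  let eta := etaOf ets T BK
  let g := gU d
  decide (3 ≤ d) && decide (ypOf x < ONE) && decide (BK + T ≤ 3 * ONE) && decide (BK < (JJ + 1) * ONE)
    && decide (g < ONE) && decide (S1of d sqd (r3U d) eta ets < ONE) && decide (S2of d g eta ets < ONE)

/-- All degrees `a ≤ d < a + n` pass the check. -/
def capCheckRange (a n : ℕ) : Bool := (List.range n).all (fun i => capCheck (a + i))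

/-- The certified pair `(S₁⁺(d), S₂⁺(d))` (inspection only). -/
def capSums (d : ℕ) : ℕ × ℕ :=
  let x := xU d
  let bts := btListx d x
  let T := Tof d x
  let ets := etTab bts T (Jd d)
  let eta := etaOf ets T (BKof bts)
  (S1of d (sqdU d) (r3U d) eta ets, S2of d (gU d) eta ets)


/-! ## The real objects the checker certifies (scaled frame; all proofs in parts 2–6) -/

noncomputable section

open Summit.RiemannHypothesis.RiemannHypothesis.Theorems.JensenPolynomials

/-- The cap sequence `c` of item 19217, literally (`M = max(10⁴, 2d³) + d`). -/
noncomputable def capFun (d : ℕ) : ℕ → ℝ := fun k : ℕ =>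
  (if k ≤ 3 then (9 / 8 : ℝ) else (k : ℝ) * 4 ^ (k - 3) / 3) * (Nat.factorial (k - 1) : ℝ) *
    (2 : ℝ) ^ ((k : ℝ) / 2) / ((max 10000 (2 * d ^ 3) + d : ℕ) : ℝ) ^ (((k : ℝ) - 2) / 2)

/-- `a(k)`. -/
noncomputable def acoef (k : ℕ) : ℝ := if k ≤ 3 then (9 / 8 : ℝ) else (k : ℝ) * 4 ^ (k - 3) / 3

/-- The scale `λ = √(d/2)`. -/
noncomputable def lam (d : ℕ) : ℝ := √((d : ℝ) / 2)

/-- `x = √(d/M)`. -/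
noncomputable def xr (d : ℕ) : ℝ := √((d : ℝ) / (Mof d : ℝ))

/-- Scaled cumulant coefficient `ẽ_j = e_j λ^j`. -/
noncomputable def et (d j : ℕ) : ℝ := cumulantCoeff (capFun d) j * lam d ^ j

/-- Scaled recursion weight `b̃_k = c_k λ^k/(k−1)!`. -/
noncomputable def bt (d k : ℕ) : ℝ := capFun d k * lam d ^ k / (Nat.factorial (k - 1) : ℝ)

/-- `P_j = (d)_j / d^j`. -/
noncomputable def Pr (d j : ℕ) : ℝ := (d.descFactorial j : ℝ) / (d : ℝ) ^ j

/-- The scaled weight `W₁(j) = (d)_j·ρ_winMin(d,j)/λ^j`. -/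
noncomputable def W1r (d j : ℕ) : ℝ := (d.descFactorial j : ℝ) * rhoWinMin d j / lam d ^ j

/-- `g = 2d/(B_d λ)`. -/
noncomputable def gr (d : ℕ) : ℝ := 2 * (d : ℝ) / (hermiteTestBound d * lam d)


end

end Summit.RiemannHypothesis.RiemannHypothesis.Theorems.JensenPolynomials.CapCert
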